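import Mathlib
import Summits.KontsevichZagierPeriods.KontsevichZagierPeriods.Theorems.InverseLandauInverseLandauRationalCurves
import Literature.NumberTheory.Transcendental.LandauDefectLatticeTate
import Summits.KontsevichZagierPeriods.KontsevichZagierPeriods.Theses.InverseLandau

/-!
# F3 WITNESS for line `InverseLandauSeparableSurfaces` on crux `TateFamilyKernel` (stmt-KontsevichZagierPeriods-9130)
# — the rung specialises to the PROVED floor (seed g1-KontsevichZagierPeriods-13872)

`Rung 1` (dimension one) is by definition the parent route's decl
`Summit.KontsevichZagierPeriods.KontsevichZagierPeriods.Theses.InverseLandau.InverseLandauRationalCurves`,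
closed by `Summit.KontsevichZagierPeriods.InverseLandau.RationalCurves.InverseLandauRationalCurves_of`
(Theorems/InverseLandauInverseLandauRationalCurves.lean, axioms propext/Classical.choice/Quot.sound). The rung
proper is `Rung 2 = InverseLandauSeparableSurfaces` (skeleton: `Lines/InverseLandauSeparableSurfaces.lean`,
composition `InverseLandauSeparableSurfaces_of` from the registered stubs `stub_periodPairing`,
`stub_pairNormalForm` (+ tool stub `stub_bilinearAx`)). The `Rung` family is restated here verbatim from the
skeleton so that this file is self-contained (Cruxes/ modules are not importable). Typed by seat
`fwd-rung-KontsevichZagierPeriods-02`, published by `fwd-harvest-KontsevichZagierPeriods-02`.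
-/

noncomputable section

open Polynomial
open scoped TensorProduct
open Literature.NumberTheory.Transcendental Literature.NumberTheory.Transcendental.AyoubRel

namespace Summit.KontsevichZagierPeriods.InverseLandau.SeparableSurfaces

def IsNullForm (K : Type) [Field K] (S : Set K) [Fintype S] (f : RatFunc K) : Prop :=
  ∃ (A B : Polynomial K) (s : ℕ) (c : Fin s → K) (nv : Fin s → (S → ℤ)),
    B.eval 0 ≠ 0 ∧ B.eval 1 ≠ 0 ∧ A.eval 1 * B.eval 0 = A.eval 0 * B.eval 1 ∧
    (∀ q, nv q ∈ Landau.relationLattice (fun p : S => landauUnit K (p : K))) ∧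
    f = algebraMap (Polynomial K) (RatFunc K) (derivative A * B - A * derivative B) /
          algebraMap (Polynomial K) (RatFunc K) (B ^ 2) +
        ∑ q, RatFunc.C (c q) * ∑ p : S, RatFunc.C ((nv q p : ℤ) : K) * (RatFunc.X - RatFunc.C (p : K))⁻¹

def boxIntegral {k : Type} [Field k] (p : MvPolynomial (Fin 2) k) : k :=
  ∑ m ∈ p.support, MvPolynomial.coeff m p * ∏ i, ((m i : k) + 1)⁻¹

def boxTensor (K : Type) [Field K] (P : MvPolynomial (Fin 2) K) (D₁ D₂ : Polynomial K) :
    RatFunc K ⊗[K] RatFunc K :=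
  ∑ m ∈ P.support, MvPolynomial.coeff m P •
    ((RatFunc.X ^ (m 0) / algebraMap (Polynomial K) (RatFunc K) D₁) ⊗ₜ[K]
      (RatFunc.X ^ (m 1) / algebraMap (Polynomial K) (RatFunc K) D₂))

def InverseLandauSeparableSurfaces : Prop :=
  ∀ (k : Type) [Field k] [CharZero k] (Q₁ Q₂ : Polynomial (Polynomial k)) (c₁ c₂ : k),
    c₁ ≠ 0 → c₂ ≠ 0 → Q₁.coeff 0 = Polynomial.C c₁ → Q₂.coeff 0 = Polynomial.C c₂ →
  ∀ (P : Polynomial (MvPolynomial (Fin 2) k)) (G : PowerSeries (MvPolynomial (Fin 2) k)),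
    ((Q₁.map (Polynomial.aeval (MvPolynomial.X 0 : MvPolynomial (Fin 2) k)).toRingHom :
          PowerSeries (MvPolynomial (Fin 2) k)) *
        (Q₂.map (Polynomial.aeval (MvPolynomial.X 1 : MvPolynomial (Fin 2) k)).toRingHom :
          PowerSeries (MvPolynomial (Fin 2) k)) * G = (P : PowerSeries (MvPolynomial (Fin 2) k))) →
    (∀ j : ℕ, boxIntegral (PowerSeries.coeff j G) = 0) →
  ∀ (K : Type) [Field K] [IsAlgClosed K] [Algebra (RatFunc k) K],
    ∃ (s : ℕ) (f g f' g' : Fin s → RatFunc K),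
      (∀ i, IsNullForm K (((TateFamily₁.toParamPoly Q₁).map (algebraMap (RatFunc k) K) *
              (TateFamily₁.toParamPoly Q₂).map (algebraMap (RatFunc k) K)).rootSet K) (f i - g' i) ∧
            IsNullForm K (((TateFamily₁.toParamPoly Q₁).map (algebraMap (RatFunc k) K) *
              (TateFamily₁.toParamPoly Q₂).map (algebraMap (RatFunc k) K)).rootSet K) (f' i - g i)) ∧
      boxTensor K
          (P.eval₂ (MvPolynomial.map ((algebraMap (RatFunc k) K).comp (algebraMap k (RatFunc k))))
            (MvPolynomial.C (algebraMap (RatFunc k) K RatFunc.X)))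
          ((TateFamily₁.toParamPoly Q₁).map (algebraMap (RatFunc k) K))
          ((TateFamily₁.toParamPoly Q₂).map (algebraMap (RatFunc k) K))
        = ∑ i, (f i ⊗ₜ[K] g i - f' i ⊗ₜ[K] g' i)

def Rung : ℕ → Prop
  | 0 => True
  | 1 => Summit.KontsevichZagierPeriods.KontsevichZagierPeriods.Theses.InverseLandau.InverseLandauRationalCurves
  | 2 => InverseLandauSeparableSurfaces
  | (_ + 3) => True  -- dimensions ≥ 3 not typed yet (LADDER.md R3–R6): placeholder, NO claim

/-- **F3 witness.** The rung at the floor's parameter (dimension `1`) IS the proved floor. -/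
example : Rung 1 := by
  simpa [Rung] using Summit.KontsevichZagierPeriods.InverseLandau.RationalCurves.InverseLandauRationalCurves_of

/-- The same, by `exact` after unfolding (documents that `Rung 1` is definitionally the floor's statement). -/
theorem rung_one : Rung 1 :=
  Summit.KontsevichZagierPeriods.InverseLandau.RationalCurves.InverseLandauRationalCurves_of

/-- Sanity: the statement of `Rung 2` is the separable-surface rung (definitional). -/
example : Rung 2 = InverseLandauSeparableSurfaces := rfl

end Summit.KontsevichZagierPeriods.InverseLandau.SeparableSurfaces

end
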